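import Summits.NavierStokesRegularity.NavierStokesRegularity.Theorems.EfficiencyFloorProductionEfficiencyDecayTypeIRecurrenceDensity
import HarnessLib

/-!
# Growth instants at every scale (line `efficiency_floor`, crux `EfficiencyFloor.ProductionEfficiencyDecay`,
# stmt-NavierStokesRegularity-22866; `--supports`)

Refinement of `Theorems/EfficiencyFloorProductionEfficiencyDecayTypeIRecurrenceDensity.lean` by Leray's
LOWER bound `Z(t) ≥ c_L ν^{3/2}/√(T−t)` (`Literature.Analysis.FluidPDE.leray_blowup_rate_enstrophy`): the
cubic-growth instants after a late Type-I time `t` (`Z(t) ≤ W/√(T−t)`) are not only of total measure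
`≳ (T−t)` in `(t,T)` but already of measure `≥ κ'(T−t)` inside the PROXIMAL window `(t, T − θ(T−t))`,
`θ = c_L²ν³/(2W²) ∈ (0, ½]` (`density_window`): under the quarter law every parabolic annulus
`T − s ∈ [θ(T−t), T−t]` before the blow-up time carries growth instants — hence concentrated
near-extremal states (`concentrated_of_growth`) — with density bounded below (`density_window_of_quarterLaw`).

HONEST FRAMING: structure theorems about a HYPOTHETICAL maximal solution of finite lifespan; the crux is
NOT proved; NS regularity is NOT proved by anything here; no summit is claimed. [folklore]
-/

-- the problem directory repeats the summit name (`NavierStokesRegularity/NavierStokesRegularity`)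
set_option linter.dupNamespace false

noncomputable section

open Set Filter MeasureTheory Topology Function
open scoped InnerProductSpace ENNReal NNReal
open Literature.Analysis.FluidPDE

namespace Summit.NavierStokesRegularity.NavierStokesRegularity.Theorems

namespace TypeIRecurrence

/-! ## 1. Real analysis: the growth set inside a window -/

/-- **Measure of the growth set in a window.** `G` differentiable on `[t,T)` with derivative `f ≤ M`
(`M > 0`), `t < t' < T`, `λ ≥ 0`: the set of `s ∈ (t,t')` with `f(s) ≥ λ` has measure at least
`(G(t') − G(t) − λ(t'−t))/M`. [folklore] -/
theorem measure_growthSet_window_ge {G f : ℝ → ℝ} {t t' T M lam : ℝ}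
    (hder : ∀ s ∈ Ico t T, HasDerivAt G (f s) s) (hM : ∀ s ∈ Ico t T, f s ≤ M) (hM0 : 0 < M)
    (hlam : 0 ≤ lam) (htt' : t < t') (ht'T : t' < T) :
    ENNReal.ofReal ((G t' - G t - lam * (t' - t)) / M) ≤ volume {s | s ∈ Ioo t t' ∧ lam ≤ f s} := by
  set A : Set ℝ := {s | s ∈ Ioo t t' ∧ lam ≤ f s} with hA
  have hAeq : A = Ioo t t' ∩ {s | lam ≤ deriv G s} := by
    ext s
    simp only [hA, mem_setOf_eq, mem_inter_iff]
    constructor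
    · rintro ⟨hs, hle⟩
      exact ⟨hs, by rwa [(hder s ⟨hs.1.le, hs.2.trans ht'T⟩).deriv]⟩
    · rintro ⟨hs, hle⟩
      exact ⟨hs, by rwa [(hder s ⟨hs.1.le, hs.2.trans ht'T⟩).deriv] at hle⟩
  have hAm : MeasurableSet A := by
    rw [hAeq]
    exact measurableSet_Ioo.inter (measurableSet_le measurable_const (measurable_deriv G))
  have hAsub : A ⊆ Ioo t t' := fun s hs => hs.1
  have hAfin : volume A ≠ ⊤ :=
    ((measure_mono hAsub).trans_lt (by rw [Real.volume_Ioo]; exact ENNReal.ofReal_lt_top)).ne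
  set a : ℝ := (volume A).toReal with ha
  have ha0 : 0 ≤ a := ENNReal.toReal_nonneg
  rw [← ENNReal.ofReal_toReal hAfin]
  refine ENNReal.ofReal_le_ofReal ?_
  rw [div_le_iff₀ hM0]
  have htt'le : t ≤ t' := htt'.le
  set φ : ℝ → ℝ := fun s => lam + A.indicator (fun _ => M - lam) s with hφ
  have hcont : ContinuousOn G (Icc t t') := fun s hs =>
    (hder s ⟨hs.1, hs.2.trans_lt ht'T⟩).continuousAt.continuousWithinAt
  have hderiv : ∀ s ∈ Ioo t t', HasDerivWithinAt G (f s) (Ioi s) s := fun s hs =>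
    (hder s ⟨hs.1.le, hs.2.trans ht'T⟩).hasDerivWithinAt
  have hIcc : volume (Icc t t') ≠ ⊤ := by rw [Real.volume_Icc]; exact ENNReal.ofReal_ne_top
  have hφint : IntegrableOn φ (Icc t t') volume :=
    (integrableOn_const hIcc).add ((integrableOn_const hIcc).indicator hAm)
  have hφg : ∀ s ∈ Ioo t t', f s ≤ φ s := by
    intro s hs
    have hsI : s ∈ Ico t T := ⟨hs.1.le, hs.2.trans ht'T⟩
    by_cases hsA : s ∈ A
    · simp only [hφ, indicator_of_mem hsA]
      linarith [hM s hsI]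
    · simp only [hφ, indicator_of_notMem hsA, add_zero]
      have : ¬ (lam ≤ f s) := fun h => hsA ⟨hs, h⟩
      exact (not_le.1 this).le
  have hFTC := intervalIntegral.sub_le_integral_of_hasDeriv_right_of_le htt'le hcont hderiv hφint hφg
  have hint : ∫ y in t..t', φ y = lam * (t' - t) + (volume (Ioc t t' ∩ A)).toReal * (M - lam) := by
    rw [intervalIntegral.integral_of_le htt'le]
    have hIoc : volume (Ioc t t') ≠ ⊤ := by rw [Real.volume_Ioc]; exact ENNReal.ofReal_ne_top
    have h1 : IntegrableOn (fun _ : ℝ => lam) (Ioc t t') volume := integrableOn_const hIoc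
    have h2 : IntegrableOn (A.indicator fun _ : ℝ => M - lam) (Ioc t t') volume :=
      (integrableOn_const hIoc).indicator hAm
    rw [integral_add h1 h2, setIntegral_const, setIntegral_indicator hAm, setIntegral_const]
    simp only [measureReal_def, Real.volume_Ioc, ENNReal.toReal_ofReal (sub_nonneg.2 htt'le),
      smul_eq_mul]
    ring
  have hv : (volume (Ioc t t' ∩ A)).toReal ≤ a :=
    ENNReal.toReal_mono hAfin (measure_mono inter_subset_right)
  have hv0 : 0 ≤ (volume (Ioc t t' ∩ A)).toReal := ENNReal.toReal_nonneg
  have hbound : ∫ y in t..t', φ y ≤ lam * (t' - t) + M * a := by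
    rw [hint]
    nlinarith [mul_le_mul_of_nonneg_left hv hM0.le, mul_nonneg hlam hv0]
  linarith [hFTC, hbound]

/-! ## 2. Leray's floor for the budget enstrophy -/

variable {ν T : ℝ} {u : ℝ → EuclideanSpace ℝ (Fin 3) → EuclideanSpace ℝ (Fin 3)}
  {p : ℝ → EuclideanSpace ℝ (Fin 3) → ℝ}

/-- **Leray's floor, budget form.** With Leray's universal constant `c_L` of
`leray_blowup_rate_enstrophy`: along a maximal smooth Leray–Hopf rapidly-decaying-datum solution,
`c_L ν^{3/2}/√(T−t) ≤ Z(t)` for the real enstrophy `Z` of the budget, at every `t ∈ (0,T)` (sub-slab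
boundedness from the Tao-class cover, `∫|∇u|²_F ≤ ∫|curl u|²`). [cite: RobinsonRodrigoSadowski2016, Lemma 6.13] -/
theorem leray_floor_Zr : ∃ cL : ℝ, 0 < cL ∧ ∀ (ν T : ℝ), 0 < ν → 0 < T →
    ∀ (u : ℝ → EuclideanSpace ℝ (Fin 3) → EuclideanSpace ℝ (Fin 3))
      (p : ℝ → EuclideanSpace ℝ (Fin 3) → ℝ),
      IsMaximalSmoothSolution ν 0 u p T → IsLerayHopfOn T ν 0 (u 0) u → HasRapidSpatialDecay (u 0) →
      ∀ (Zr : ℝ → ℝ), (∀ t ∈ Ioo 0 T, ∫⁻ x, ‖curl (u t) x‖ₑ ^ 2 = ENNReal.ofReal (Zr t)) →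
      (∀ t ∈ Ioo 0 T, 0 ≤ Zr t) →
      ∀ t ∈ Ioo 0 T, cL * ν ^ (3 / 2 : ℝ) / Real.sqrt (T - t) ≤ Zr t := by
  obtain ⟨c, hc, hrate⟩ := leray_blowup_rate_enstrophy
  refine ⟨c, hc, fun ν T hν hT u p hmax hLH hdec Zr hZeq hZ0 t ht => ?_⟩
  have hsol := hmax.isClassicalNSSolutionOn
  have htI : t ∈ Ico 0 T := ⟨ht.1.le, ht.2⟩
  have hfloor := hrate ν T hν hT u p hmax hLH
    (BlowupEnstrophyUnbounded.eLpNorm_uncurry_top_lt_top hν hT hsol hLH hdec) t htI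
  have hL2 : ∫⁻ x, ‖u t x‖ₑ ^ 2 < ⊤ :=
    (hLH.lintegral_enorm_sq_le hν.le ⟨htI.1, htI.2.le⟩).trans_lt ENNReal.ofReal_lt_top
  have hcurl : ∫⁻ x, ENNReal.ofReal (frobeniusNormSq (fderiv ℝ (u t) x)) ≤
      ∫⁻ x, ‖curl (u t) x‖ₑ ^ 2 :=
    lintegral_frobeniusNormSq_fderiv_le_lintegral_sq_norm_curl
      ((hsol.contDiff_velocity htI).of_le (by norm_cast)) (hsol.divFree t htI) hL2
  have h := (hfloor.trans hcurl)
  rw [hZeq t ht] at h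
  have hTt : 0 < T - t := sub_pos.2 ht.2
  have h' := (ENNReal.ofReal_le_ofReal_iff (hZ0 t ht)).1 h
  rwa [Real.rpow_neg hTt.le, ← Real.sqrt_eq_rpow, ← div_eq_mul_inv] at h'

/-! ## 3. Growth instants in the proximal window -/

/-- **Density of growth instants in the proximal window.** Along a maximal smooth Leray–Hopf
rapidly-decaying-datum solution with budget `(Z, Pal, S)`, envelope constant `c` and a Leray floor
`A/√(T−s) ≤ Z(s)` on `(0,T)` (`A > 0`): eventually, at every time `t` with `Z(t) ≤ W/√(T−t)`, the
cubic-growth instants `Z³/(8W²) ≤ Ż` inside the window `(t, T − θ(T−t))`, `θ = A²/(2W²)` (`≤ ½`), have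
measure at least `(16ν³/(27c⁴W²))·(T−t)`. [folklore] -/
theorem density_window (hν : 0 < ν) (hT : 0 < T) (hmax : IsMaximalSmoothSolution ν 0 u p T)
    (hLH : IsLerayHopfOn T ν 0 (u 0) u) (hdec : HasRapidSpatialDecay (u 0)) {c : ℝ} (hc : 0 < c)
    {Zr Pr Sr : ℝ → ℝ}
    (hZ : ∀ t ∈ Set.Ioo 0 T,
      ∫⁻ x, ‖curl (u t) x‖ₑ ^ 2 = ENNReal.ofReal (Zr t) ∧ 0 ≤ Zr t ∧ 0 ≤ Pr t ∧
      Pr t = ∫ x, frobeniusNormSq (fderiv ℝ (curl (u t)) x) ∧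
      Sr t = ∫ x, ⟪curl (u t) x, fderiv ℝ (u t) x (curl (u t) x)⟫_ℝ ∧
      HasDerivAt Zr (2 * Sr t - 2 * ν * Pr t) t ∧
      |Sr t| ≤ c * Zr t ^ (3 / 4 : ℝ) * Pr t ^ (3 / 4 : ℝ))
    {A : ℝ} (hA : 0 < A) (hfloor : ∀ s ∈ Ioo 0 T, A / Real.sqrt (T - s) ≤ Zr s)
    {W : ℝ} (hW : 0 < W) :
    ∀ᶠ t in 𝓝[<] T, ∫⁻ x, ‖curl (u t) x‖ₑ ^ 2 ≤ ENNReal.ofReal (W / Real.sqrt (T - t)) →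
      A ^ 2 / (2 * W ^ 2) ≤ 1 / 2 ∧
      ENNReal.ofReal (16 * ν ^ 3 / (27 * c ^ 4 * W ^ 2) * (T - t)) ≤
        volume {s | s ∈ Ioo t (T - A ^ 2 / (2 * W ^ 2) * (T - t)) ∧ 0 < Zr s ∧
          Zr s ^ 3 / (8 * W ^ 2) ≤ 2 * Sr s - 2 * ν * Pr s} := by
  -- a late window on which `Z ≥ 1`
  obtain ⟨t₁, ht₁T, ht₁⟩ := mem_nhdsLT_iff_exists_Ioo_subset.1
    (eventually_le_Zr hν hT hmax hLH hdec (fun t ht => (hZ t ht).1) (fun t ht => (hZ t ht).2.1) 1)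
  filter_upwards [Ioo_mem_nhdsLT ht₁T] with t ht hbound
  have htT : t < T := ht.2
  have hwin : ∀ s ∈ Ico t T, s ∈ Ioo 0 T ∧ 1 ≤ Zr s := fun s hs => ht₁ ⟨ht.1.trans_le hs.1, hs.2⟩
  have htI : t ∈ Ioo 0 T := (hwin t ⟨le_rfl, htT⟩).1
  have hZt : 0 < Zr t := one_pos.trans_le (hwin t ⟨le_rfl, htT⟩).2
  have hTt : 0 < T - t := sub_pos.2 htT
  have hW2 : 0 < W ^ 2 := pow_pos hW 2
  -- `Z(t) ≤ W/√(T−t)` and the floor give `A ≤ W`, so `θ ≤ 1/2`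
  have hZle : Zr t ≤ W / Real.sqrt (T - t) := by
    have h := hbound
    rw [(hZ t htI).1] at h
    exact (ENNReal.ofReal_le_ofReal_iff (by positivity)).1 h
  have hsq : 0 < Real.sqrt (T - t) := Real.sqrt_pos.2 hTt
  have hAW : A ≤ W := by
    have := (hfloor t htI).trans hZle
    rwa [div_le_div_iff_of_pos_right hsq] at this
  set θ : ℝ := A ^ 2 / (2 * W ^ 2) with hθ
  have hθpos : 0 < θ := by positivity
  have hθhalf : θ ≤ 1 / 2 := by
    rw [hθ, div_le_div_iff₀ (by positivity) two_pos]
    nlinarith [mul_pos hA hA, mul_self_le_mul_self hA.le hAW]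
  refine ⟨hθhalf, ?_⟩
  -- the window end `t' = T − θ(T−t)`
  set t' : ℝ := T - θ * (T - t) with ht'
  have htt' : t < t' := by rw [ht']; nlinarith
  have ht'T : t' < T := by rw [ht']; nlinarith
  have ht'I : t' ∈ Ioo 0 T := ⟨htI.1.trans htt', ht'T⟩
  -- `G = −Z⁻²`, `f = 2Ż/Z³ ≤ M`
  set G : ℝ → ℝ := fun s => -((Zr s)⁻¹ ^ 2) with hG
  set f : ℝ → ℝ := fun s => 2 * (2 * Sr s - 2 * ν * Pr s) / Zr s ^ 3 with hf
  set M : ℝ := 27 * c ^ 4 / (64 * ν ^ 3) with hM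
  have hM0 : 0 < M := by positivity
  have hder : ∀ s ∈ Ico t T, HasDerivAt G (f s) s := by
    intro s hs
    have hZs : Zr s ≠ 0 := (one_pos.trans_le (hwin s hs).2).ne'
    have h := (ProductionEfficiencyDecay.hasDerivAt_inv_sq (hZ s (hwin s hs).1).2.2.2.2.2.1 hZs).neg
    refine h.congr_deriv ?_
    simp only [hf]
    ring
  have hfM : ∀ s ∈ Ico t T, f s ≤ M := by
    intro s hs
    obtain ⟨-, hZ0, hP0, -, -, -, henv⟩ := hZ s (hwin s hs).1
    have hZs : 0 < Zr s := one_pos.trans_le (hwin s hs).2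
    have hZ3 : 0 < Zr s ^ 3 := pow_pos hZs 3
    have hcl := cubic_law hc hν hZ0 hP0 henv
    simp only [hf, hM]
    rw [div_le_iff₀ hZ3]
    have : 27 * c ^ 4 / (64 * ν ^ 3) * Zr s ^ 3 = 2 * (27 * c ^ 4 / (128 * ν ^ 3) * Zr s ^ 3) := by
      ring
    rw [this]
    linarith
  -- `G(t) ≤ −(T−t)/W²` and `G(t') ≥ −θ(T−t)/A² = −(T−t)/(2W²)`
  have hGt : G t ≤ -((T - t) / W ^ 2) := by
    have h1 : Zr t ^ 2 ≤ W ^ 2 / (T - t) := by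
      calc Zr t ^ 2 ≤ (W / Real.sqrt (T - t)) ^ 2 := pow_le_pow_left₀ hZt.le hZle 2
        _ = W ^ 2 / (T - t) := by rw [div_pow, Real.sq_sqrt hTt.le]
    have h2 : (W ^ 2 / (T - t))⁻¹ ≤ (Zr t ^ 2)⁻¹ := inv_anti₀ (pow_pos hZt 2) h1
    rw [inv_div] at h2
    simp only [hG, inv_pow, neg_le_neg_iff]
    exact h2
  have hGt' : -((T - t) / (2 * W ^ 2)) ≤ G t' := by
    have hTt' : 0 < T - t' := sub_pos.2 ht'T
    have hZt' : 0 < Zr t' := one_pos.trans_le (hwin t' ⟨htt'.le, ht'T⟩).2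
    have h1 : A ^ 2 / (T - t') ≤ Zr t' ^ 2 := by
      calc A ^ 2 / (T - t') = (A / Real.sqrt (T - t')) ^ 2 := by
            rw [div_pow, Real.sq_sqrt hTt'.le]
        _ ≤ Zr t' ^ 2 := pow_le_pow_left₀ (by positivity) (hfloor t' ht'I) 2
    have h2 : (Zr t' ^ 2)⁻¹ ≤ (A ^ 2 / (T - t'))⁻¹ := inv_anti₀ (by positivity) h1
    rw [inv_div] at h2
    have h3 : (T - t') / A ^ 2 = (T - t) / (2 * W ^ 2) := by
      rw [ht', hθ]
      field_simp
      ring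
    simp only [hG, inv_pow, neg_le_neg_iff]
    rw [← h3]
    exact h2
  -- the window measure lemma with `λ = 1/(4W²)`
  have hmeas := measure_growthSet_window_ge (lam := 1 / (4 * W ^ 2)) hder hfM hM0 (by positivity)
    htt' ht'T
  have hκ : 16 * ν ^ 3 / (27 * c ^ 4 * W ^ 2) * (T - t) ≤
      (G t' - G t - 1 / (4 * W ^ 2) * (t' - t)) / M := by
    rw [le_div_iff₀ hM0]
    have h1 : 16 * ν ^ 3 / (27 * c ^ 4 * W ^ 2) * (T - t) * M = (T - t) / (4 * W ^ 2) := by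
      simp only [hM]
      field_simp
      ring
    rw [h1]
    have h2 : 1 / (4 * W ^ 2) * (t' - t) ≤ (T - t) / (4 * W ^ 2) := by
      rw [one_div_mul_eq_div]
      exact div_le_div_of_nonneg_right (by linarith) (by positivity)
    have h3 : (T - t) / (4 * W ^ 2) + (T - t) / (4 * W ^ 2) = (T - t) / (2 * W ^ 2) := by ring
    have h4 : (T - t) / (2 * W ^ 2) + (T - t) / (2 * W ^ 2) = (T - t) / W ^ 2 := by ring
    linarith
  refine ((ENNReal.ofReal_le_ofReal hκ).trans hmeas).trans (measure_mono ?_)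
  rintro s ⟨hs, hle⟩
  have hsI : s ∈ Ico t T := ⟨hs.1.le, hs.2.trans ht'T⟩
  have hZs : 0 < Zr s := one_pos.trans_le (hwin s hsI).2
  have hZ3 : 0 < Zr s ^ 3 := pow_pos hZs 3
  refine ⟨hs, hZs, ?_⟩
  simp only [hf] at hle
  rw [le_div_iff₀ hZ3] at hle
  rw [div_le_iff₀ (by positivity : (0:ℝ) < 8 * W ^ 2)]
  have h4 : 1 / (4 * W ^ 2) * Zr s ^ 3 * (8 * W ^ 2) = 2 * Zr s ^ 3 := by field_simp; ring
  nlinarith [hle, h4, hZ3, hW2]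

/-- **Under the quarter law, concentrated near-extremal states at every scale.** For every `ν, K`
(`ν > 0`) there are `δ₀, R₀, θ, κ > 0`, `θ ≤ ½`, such that along every maximal smooth Leray–Hopf
rapidly-decaying-datum solution on `[0,T)` with `Z(t) ≤ K/√(T−t)` on `[0,T)`: eventually, for EVERY `t`,
the times `s` in the proximal window `(t, T − θ(T−t))` at which a `δ₀`-fraction of the enstrophy sits in
one ball of radius `R₀/Z(s)` have measure at least `κ(T−t)`. Nothing about NS regularity is asserted.
[folklore] -/
theorem density_window_of_quarterLaw {ν K : ℝ} (hν : 0 < ν) :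
    ∃ δ₀ R₀ θ κ : ℝ, 0 < δ₀ ∧ 0 < R₀ ∧ 0 < θ ∧ θ ≤ 1 / 2 ∧ 0 < κ ∧ ∀ (T : ℝ), 0 < T →
    ∀ (u : ℝ → EuclideanSpace ℝ (Fin 3) → EuclideanSpace ℝ (Fin 3))
      (p : ℝ → EuclideanSpace ℝ (Fin 3) → ℝ),
      IsMaximalSmoothSolution ν 0 u p T → IsLerayHopfOn T ν 0 (u 0) u → HasRapidSpatialDecay (u 0) →
      (∀ t ∈ Ico 0 T, ∫⁻ x, ‖curl (u t) x‖ₑ ^ 2 ≤ ENNReal.ofReal (K / Real.sqrt (T - t))) →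
      ∀ᶠ t in 𝓝[<] T, ENNReal.ofReal (κ * (T - t)) ≤
          volume {s | s ∈ Ioo t (T - θ * (T - t)) ∧ 0 < ∫ x, ‖curl (u s) x‖ ^ 2 ∧
            ∃ a : EuclideanSpace ℝ (Fin 3), δ₀ * ∫ x, ‖curl (u s) x‖ ^ 2 ≤
              ∫ x in Metric.ball a (R₀ / ∫ x, ‖curl (u s) x‖ ^ 2), ‖curl (u s) x‖ ^ 2} := by
  obtain ⟨c, hc, hB⟩ := EnstrophyBudget.main
  obtain ⟨cL, hcL, hL⟩ := leray_floor_Zr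
  set W : ℝ := max K 1 with hWdef
  have hW : 0 < W := lt_max_of_lt_right one_pos
  set A : ℝ := min (cL * ν ^ (3 / 2 : ℝ)) W with hAdef
  have hA : 0 < A := lt_min (by positivity) hW
  have hAW : A ≤ W := min_le_right _ _
  obtain ⟨ε₀, hε₀⟩ : ∃ ε₀ : ℝ, ε₀ = 1 / (8 * W ^ 2) := ⟨_, rfl⟩
  have hε₀pos : 0 < ε₀ := by rw [hε₀]; positivity
  obtain ⟨Kc, δ, hKc, hδ, hS5⟩ :=
    ProductionEfficiencyDecay.stub_efficiencyConcentration (ε₀ * ν ^ 3 / (2 * c ^ 3)) (by positivity)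
  have hApos : 0 < (2 * c / ε₀) ^ (4 / 3 : ℝ) := Real.rpow_pos_of_pos (by positivity) _
  have hθhalf : A ^ 2 / (2 * W ^ 2) ≤ 1 / 2 := by
    rw [div_le_div_iff₀ (by positivity) two_pos]
    nlinarith [mul_pos hA hA, mul_self_le_mul_self hA.le hAW]
  refine ⟨δ, Kc * Real.sqrt ((2 * c / ε₀) ^ (4 / 3 : ℝ)), A ^ 2 / (2 * W ^ 2),
    16 * ν ^ 3 / (27 * c ^ 4 * W ^ 2), hδ, mul_pos hKc (Real.sqrt_pos.2 hApos), by positivity, hθhalf,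
    by positivity, ?_⟩
  intro T hT u p hmax hLH hdec hq
  obtain ⟨Zr, Pr, Sr, hZ⟩ := hB ν T hν hT u p hmax hLH hdec
  have hfloor : ∀ s ∈ Ioo 0 T, A / Real.sqrt (T - s) ≤ Zr s := fun s hs =>
    (div_le_div_of_nonneg_right (min_le_left _ _) (Real.sqrt_nonneg _)).trans
      (hL ν T hν hT u p hmax hLH hdec Zr (fun t ht => (hZ t ht).1) (fun t ht => (hZ t ht).2.1) s hs)
  filter_upwards [density_window hν hT hmax hLH hdec hc hZ hA hfloor hW, Ioo_mem_nhdsLT hT]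
    with t ht ht0
  have hbound : ∫⁻ x, ‖curl (u t) x‖ₑ ^ 2 ≤ ENNReal.ofReal (W / Real.sqrt (T - t)) :=
    (hq t ⟨ht0.1.le, ht0.2⟩).trans
      (ENNReal.ofReal_le_ofReal (div_le_div_of_nonneg_right (le_max_left _ _) (Real.sqrt_nonneg _)))
  refine ((ht hbound).2).trans (measure_mono ?_)
  rintro s ⟨hs, hZs, hgrow⟩
  have hθT : T - A ^ 2 / (2 * W ^ 2) * (T - t) ≤ T := by
    have : 0 ≤ A ^ 2 / (2 * W ^ 2) * (T - t) := by
      have := sub_pos.2 ht0.2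
      positivity
    linarith
  have hsI : s ∈ Ioo 0 T := ⟨ht0.1.trans hs.1, hs.2.trans_le hθT⟩
  obtain ⟨hZeq, -, hP0, hPeq, hSeq, -, henv⟩ := hZ s hsI
  have hgrow' : ε₀ * Zr s ^ 3 ≤ 2 * Sr s - 2 * ν * Pr s := by
    have : ε₀ * Zr s ^ 3 = Zr s ^ 3 / (8 * W ^ 2) := by rw [hε₀]; ring
    rw [this]; exact hgrow
  exact ⟨hs, concentrated_of_growth hν hT hmax hLH hdec hc hε₀pos hKc hS5 hsI hZeq hZs hP0 hPeq hSeq henv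
    hgrow'⟩

end TypeIRecurrence

end Summit.NavierStokesRegularity.NavierStokesRegularity.Theorems

end
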